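import Summits.HodgeConjecture.HodgeConjecture.Theses.LinearSystemTorelli
import Summits.HodgeConjecture.HodgeConjecture.Theorems.LinearSystemTorelliTranscendentalOrSupportedStubDoublePerp
import Summits.HodgeConjecture.HodgeConjecture.Theorems.LinearSystemTorelliTranscendentalOrSupportedStubPerpRatSpanned
import Summits.HodgeConjecture.HodgeConjecture.Theorems.LinearSystemTorelliTranscendentalOrSupportedStubPerpSubHodge
import Literature.AlgebraicGeometry.HodgeTheory.VanishingCohomologyNontrivialProofs
import Literature.AlgebraicGeometry.HodgeTheory.HodgeTypeConjugation
import Literature.AlgebraicGeometry.Motives.ComplexPointsOrientation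
import Literature.AlgebraicTopology.SingularHomology.CupProductProofs

/-!
# Crux `TranscendentalOrSupported` (stmt-HodgeConjecture-10853), line `Sketch` — REMARKS (lead), III:
# the core `InvisibleTranscendental` FOLLOWS from the bet `InvisiblePerp`

Companion of `Lines/Sketch.lean`, closing the circle of reformulations of the line:

  `InvisibleTranscendental` (core) ⟹ `InvisiblePerp` (bet)      — skeleton (`invisiblePerp_of`, with
                                                                     the landed `stub_perpRatSpanned`,
                                                                     `stub_perpSubHodge`);
  `InvisiblePerp` ⟹ crux                                          — skeleton (Poincaré duality);
  crux ⟹ `InvisiblePerp` (mod Deligne 8.2.8)                      — `Sketch_remarks.lean`;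
  `InvisiblePerp` ⟹ `InvisibleTranscendental`                     — THIS FILE.

So, modulo Deligne's Gysin description of `N¹`, the crux GHC(2p, 1) for `X` is EQUIVALENT to the
route's thesis in its sharpest form: the classes of `H²ᵖ(X(ℂ); ℂ)` invisible on every smooth projective
variety of dimension `< 2p` over `X` are exactly the transcendental part `T(X) ⊗ ℂ`.

Proof of `InvisiblePerp ⟹ InvisibleTranscendental`. Let `c` be invisible and `V` a rationally spanned
sub-Hodge structure containing the `(2p,0)`-classes; pick a finite rational spanning family `v` of `V`
and a finite rational spanning family `b` of the right-orthogonal `V⊥ = ⨅ᵢ ker ⟨v i ⌣ –, [X]⟩`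
(rationally spanned: `stub_perpRatSpanned`). The bet applies to `b`: `span b = V⊥` is a sub-Hodge
structure (`perpSubHodge_isSubHodge`) and meets `H^{2p,0}` in `0` (a `(2p,0)`-class `σ ∈ V⊥` pairs to
zero with every class: with the non-`(0,2p)` types by type-orthogonality, and with the `(0,2p)`-classes
because they lie in `V` — conjugates of `(2p,0)`-classes, `V` being conjugation-stable — and the pairing
is symmetric in the even degree `2p`; so `σ = 0` by perfectness). Hence `⟨b j ⌣ c, [X]⟩ = 0` for all
`j`, i.e. `c` is right-orthogonal to `V⊥`, i.e. (symmetry) `⟨c ⌣ c', [X]⟩ = 0` for every `c'`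
right-orthogonal to `V`, and `c ∈ V` by `S = S⊥⊥` (`stub_doublePerp`).
-/

noncomputable section

set_option linter.dupNamespace false

open CategoryTheory
open Literature.AlgebraicGeometry.Motives Literature.AlgebraicGeometry.HodgeTheory
open Literature.AlgebraicTopology.SingularHomology
open Summit.HodgeConjecture.HodgeConjecture.Theorems

namespace Summit.HodgeConjecture.HodgeConjecture.Cruxes.TranscendentalOrSupported.CurveSweep

variable {n : ℕ} {X : SchemeOver ℂ}

/-- **A rationally spanned subspace of `Hᵏ(X(ℂ); ℂ)` is the span of finitely many of its rational
classes** (`Hᵏ(X(ℂ); ℂ)` is finite-dimensional, `finite_complexBetti`; take a linearly independent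
spanning subfamily of the rational classes of `V`). -/
theorem exists_fin_isRationalClass_span_eq (hX : IsSmoothProjective n X) (k : ℕ)
    (V : Submodule ℂ (complexBetti X k))
    (hV : Submodule.span ℂ {x : complexBetti X k | x ∈ V ∧ IsRationalClass x} = V) :
    ∃ (r : ℕ) (v : Fin r → complexBetti X k), (∀ i, IsRationalClass (v i)) ∧
      Submodule.span ℂ (Set.range v) = V := by
  haveI : Module.Finite ℂ (complexBetti X k) := finite_complexBetti hX k
  obtain ⟨t, ht, hspan, hli⟩ :=
    exists_linearIndependent ℂ {x : complexBetti X k | x ∈ V ∧ IsRationalClass x}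
  have htfin : t.Finite := hli.set_finite_of_isNoetherian
  haveI : Fintype t := htfin.fintype
  refine ⟨Fintype.card t, (↑) ∘ (Fintype.equivFin t).symm, fun i ↦ (ht ((Fintype.equivFin t).symm i).2).2, ?_⟩
  rw [EquivLike.range_comp, Subtype.range_coe, hspan, hV]

/-- **The cup product pairing of the `2p`-fold `X` is symmetric in degree `2p`**
(graded commutativity `cupProduct_gradedComm_holds` with the even sign `(-1)^{2p·2p} = 1`). -/
theorem cupPairing_symm (μ : OrientationFamily) {p : ℕ} (hX : IsSmoothProjective (2 * p) X)
    (a b : complexBetti X (2 * p)) :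
    cupPairing (μ hX) (two_mul (2 * p)).symm a b = cupPairing (μ hX) (two_mul (2 * p)).symm b a := by
  have h := cupPairing_flip (cupProduct_gradedComm_holds ℂ (ComplexPoints X)) (μ hX)
    (two_mul (2 * p)).symm (two_mul (2 * p)).symm
  have hsign : ((-1 : ℂ) ^ (2 * p * (2 * p))) = 1 := by
    rw [mul_assoc, pow_mul, neg_one_sq, one_pow]
  rw [hsign, one_smul] at h
  rw [← LinearMap.flip_apply (cupPairing (μ hX) (two_mul (2 * p)).symm) b a, h]

/-- **A `(2p, 0)`-class right-orthogonal to a conjugation-stable sub-Hodge structure `V ∋ H^{2p,0}`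
vanishes.** Let `V = span v` (`v` rational) contain every class of type `(2p, 0)` and let `σ` of type
`(2p, 0)` satisfy `⟨v i ⌣ σ, [X]⟩ = 0` for all `i`. Then `σ = 0`: `σ` pairs to zero with the classes of
type `≠ (0, 2p)` by type-orthogonality, and with a `(0, 2p)`-class `z` because `z ∈ V`
(`conj z` is of type `(2p, 0)`, so `conj z ∈ V`, and `V` is conjugation-stable,
`conjClass_mem_span_of_isRationalClass`) and the pairing is symmetric; the cup pairing being perfect
(`eq_zero_of_forall_cupPairing_eq_zero`), `σ = 0`. -/
theorem eq_zero_of_top_of_perp (μ : OrientationFamily) {p : ℕ} (hX : IsSmoothProjective (2 * p) X)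
    (A : HodgeModel (2 * p) X) {r : ℕ} {v : Fin r → complexBetti X (2 * p)}
    (hv : ∀ i, IsRationalClass (v i))
    (hVtop : ∀ x : complexBetti X (2 * p), A.pullback (2 * p) x ∈ A.hodgePQ (2 * p) (2 * p) 0 →
      x ∈ Submodule.span ℂ (Set.range v))
    {σ : complexBetti X (2 * p)} (hσ : σ ∈ ⨅ i, LinearMap.ker (cupPairing (μ hX) (two_mul (2 * p)).symm (v i)))
    (hσt : A.pullback (2 * p) σ ∈ A.hodgePQ (2 * p) (2 * p) 0) : σ = 0 := by
  classical
  have hsym : A.IsHodgeSymmetric := A.isHodgeSymmetric hX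
  refine eq_zero_of_forall_cupPairing_eq_zero μ hX (two_mul (2 * p)).symm fun y ↦ ?_
  obtain ⟨z, hzy, hz⟩ := A.exists_sum_eq_of_hodgeDecomposition (2 * p) y
  -- every Hodge component of `y` pairs to zero with `σ`
  have hterm : ∀ i ∈ Finset.HasAntidiagonal.antidiagonal (2 * p),
      cupPairing (μ hX) (two_mul (2 * p)).symm σ (z i) = 0 := by
    rintro ⟨a, d⟩ hi
    have had : a + d = 2 * p := Finset.HasAntidiagonal.mem_antidiagonal.1 hi
    have hzt : A.pullback (2 * p) (z (a, d)) ∈ A.hodgePQ (2 * p) a d := hz (a, d) hi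
    by_cases h0 : a = 0
    · -- `z (0, 2p)` is a `(0, 2p)`-class, hence lies in `V`; use symmetry and `σ ∈ V⊥`
      have hd : d = 2 * p := by omega
      subst h0
      subst hd
      have hct : A.pullback (2 * p) (conjClass (ComplexPoints X) (2 * p) (z (0, 2 * p))) ∈
          A.hodgePQ (2 * p) (2 * p) 0 := by
        rw [A.pullback_conjClass]
        exact hsym (2 * p) 0 (2 * p) _ hzt
      have hconj : conjClass (ComplexPoints X) (2 * p) (z (0, 2 * p)) ∈ Submodule.span ℂ (Set.range v) :=
        hVtop _ hct
      have hzi : z (0, 2 * p) ∈ Submodule.span ℂ (Set.range v) :=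
        conjClass_conjClass (z (0, 2 * p)) ▸ conjClass_mem_span_of_isRationalClass hv hconj
      exact (cupPairing_symm μ hX _ _).trans
        (perpSubHodge_cupPairing_eq_zero_of_mem_span μ hX (two_mul (2 * p)).symm hσ hzi)
    · -- non-complementary types
      refine perpSubHodge_cupPairing_eq_zero_of_hodgeType μ hX A (two_mul (2 * p)).symm ?_ hσt hzt
      rintro ⟨h1, _⟩
      exact h0 (by omega)
  calc cupPairing (μ hX) (two_mul (2 * p)).symm σ y
      = cupPairing (μ hX) (two_mul (2 * p)).symm σ (∑ i ∈ Finset.HasAntidiagonal.antidiagonal (2 * p), z i) := by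
        rw [hzy]
    _ = ∑ i ∈ Finset.HasAntidiagonal.antidiagonal (2 * p), cupPairing (μ hX) (two_mul (2 * p)).symm σ (z i) :=
        map_sum _ _ _
    _ = 0 := Finset.sum_eq_zero hterm

/-- **`InvisiblePerp ⟹ InvisibleTranscendental`**: the bet of the line implies its core (statements
written out in tree vocabulary, as registered). See the module docstring for the proof. -/
theorem invisibleTranscendental_of_invisiblePerp
    (hIP : ∀ ⦃p : ℕ⦄ ⦃X : SchemeOver ℂ⦄, 2 ≤ p → ∀ (hX : IsSmoothProjective (2 * p) X)
      (A : HodgeModel (2 * p) X) (r : ℕ) (b : Fin r → complexBetti X (2 * p)),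
      (∀ j, IsRationalClass (b j)) →
      (Submodule.span ℂ (Set.range b)).map (A.pullback (2 * p)).hom =
        ⨆ (p' : ℕ) (q' : ℕ) (_ : p' + q' = 2 * p),
          (Submodule.span ℂ (Set.range b)).map (A.pullback (2 * p)).hom ⊓ A.hodgePQ (2 * p) p' q' →
      (Submodule.span ℂ (Set.range b)).map (A.pullback (2 * p)).hom ⊓ A.hodgePQ (2 * p) (2 * p) 0 = ⊥ →
      ∀ (μ : OrientationFamily) (j : Fin r) (c : complexBetti X (2 * p)),
        (∀ (m : ℕ) (Y : SchemeOver ℂ), IsSmoothProjective m Y → m < 2 * p → ∀ g : Y ⟶ X,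
          complexBetti.map g (2 * p) c = 0) →
        cupPairing (μ hX) (two_mul (2 * p)).symm (b j) c = 0) :
    ∀ ⦃p : ℕ⦄ ⦃X : SchemeOver ℂ⦄, 2 ≤ p → ∀ (hX : IsSmoothProjective (2 * p) X)
    (A : HodgeModel (2 * p) X) (c : complexBetti X (2 * p)),
    (∀ (m : ℕ) (Y : SchemeOver ℂ), IsSmoothProjective m Y → m < 2 * p → ∀ g : Y ⟶ X,
      complexBetti.map g (2 * p) c = 0) →
    ∀ (V : Submodule ℂ (complexBetti X (2 * p))),
      Submodule.span ℂ {x : complexBetti X (2 * p) | x ∈ V ∧ IsRationalClass x} = V →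
      V.map (A.pullback (2 * p)).hom =
        ⨆ (p' : ℕ) (q' : ℕ) (_ : p' + q' = 2 * p),
          V.map (A.pullback (2 * p)).hom ⊓ A.hodgePQ (2 * p) p' q' →
      (∀ x : complexBetti X (2 * p), A.pullback (2 * p) x ∈ A.hodgePQ (2 * p) (2 * p) 0 → x ∈ V) →
      c ∈ V := by
  intro p X hp hX A c hc V hVrat hVsub hVtop
  classical
  let μ : OrientationFamily := fun _ _ h ↦ Classical.choice (ComplexPoints.isOrientableOver ℂ h)
  -- a finite rational spanning family `v` of `V`
  obtain ⟨r, v, hv, hvV⟩ := exists_fin_isRationalClass_span_eq hX (2 * p) V hVrat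
  subst hvV
  -- the right-orthogonal `V⊥` and a finite rational spanning family `b` of it
  set P : Submodule ℂ (complexBetti X (2 * p)) :=
    ⨅ i, LinearMap.ker (cupPairing (μ hX) (two_mul (2 * p)).symm (v i)) with hP
  have hPrat : Submodule.span ℂ {x : complexBetti X (2 * p) | x ∈ P ∧ IsRationalClass x} = P :=
    stub_perpRatSpanned μ hX r v hv
  obtain ⟨r', b, hb, hbP⟩ := exists_fin_isRationalClass_span_eq hX (2 * p) P hPrat
  -- the bet applies to `b`
  have hsub : (Submodule.span ℂ (Set.range b)).map (A.pullback (2 * p)).hom =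
      ⨆ (p' : ℕ) (q' : ℕ) (_ : p' + q' = 2 * p),
        (Submodule.span ℂ (Set.range b)).map (A.pullback (2 * p)).hom ⊓ A.hodgePQ (2 * p) p' q' := by
    rw [hbP]
    exact perpSubHodge_isSubHodge μ hX A v hVsub
  have hbot : (Submodule.span ℂ (Set.range b)).map (A.pullback (2 * p)).hom ⊓
      A.hodgePQ (2 * p) (2 * p) 0 = ⊥ := by
    rw [eq_bot_iff]
    rintro _ ⟨⟨σ, hσ, rfl⟩, hσt⟩
    rw [hbP] at hσ
    obtain rfl : σ = 0 := eq_zero_of_top_of_perp μ hX A hv hVtop hσ hσt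
    rw [map_zero]
    exact Submodule.zero_mem _
  have hperp : ∀ j, cupPairing (μ hX) (two_mul (2 * p)).symm (b j) c = 0 :=
    fun j ↦ hIP hp hX A r' b hb hsub hbot μ j c hc
  -- `c` is right-orthogonal to `V⊥`, hence in `V` by `S = S⊥⊥`
  have hcP : c ∈ ⨅ j, LinearMap.ker (cupPairing (μ hX) (two_mul (2 * p)).symm (b j)) :=
    (Submodule.mem_iInf _).2 fun j ↦ LinearMap.mem_ker.2 (hperp j)
  refine stub_doublePerp μ hX (two_mul (2 * p)).symm (Submodule.span ℂ (Set.range v)) c fun c' hc' ↦ ?_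
  have hc'P : c' ∈ P := (Submodule.mem_iInf _).2 fun i ↦
    LinearMap.mem_ker.2 (hc' (v i) (Submodule.subset_span ⟨i, rfl⟩))
  rw [← hbP] at hc'P
  exact (cupPairing_symm μ hX _ _).trans
    (perpSubHodge_cupPairing_eq_zero_of_mem_span μ hX (two_mul (2 * p)).symm hcP hc'P)

end Summit.HodgeConjecture.HodgeConjecture.Cruxes.TranscendentalOrSupported.CurveSweep

end
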